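import Literature.MathematicalPhysics.QuantumLattice.DWaveSourceTorusWordLineBound
import Literature.MathematicalPhysics.QuantumLattice.PairWordSingleScalePressure
import HarnessLib

/-!
# Joint perturbation theory in the interaction AND the pair source converges uniformly in the volume

Topic `MathematicalPhysics/QuantumLattice`; the assembly of the word expansion
(`PairWordSingleScalePressure`) for the `d`-wave–sourced Hubbard torus written as a pair-word
perturbation of the free Nambu gas (`DWaveSourceTorusPairWords`, `DWaveSourceTorusWordLineBound`).
For `β ≥ 0`, `μ` there are `δ, ϱ > 0`, `A ≥ 0` such that for every `L ≥ 3`, with the source-free,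
interaction-free Nambu operator `𝓚₀ = shibaOneBody τ_L Δ_{L,0} μ 0` and the coefficients

`C_{j,m}(L) = ∫_{Δ_j} (-β)^j Σ_{g : exactly m source letters} (∏_i v_{g i}(1,1)) 𝓔ᵀ_j(g, -βu) du`

(words of `j` letters of which `m` are source bond letters and `j - m` interaction letters, unit couplings):

* `‖C_{j,m}(L)‖ ≤ L² A ϱ^j` (`j ≥ 1`), uniformly in `L`;
* for all real `|U|, |h| ≤ δ`: the connected coefficients of the sourced interacting torus are the
  homogeneous polynomials `c_j(L; U, h) = Σ_{m ≤ j} C_{j,m}(L) U^{j-m} h^m`, `‖c_j‖ ≤ L² A (j+1) 3^{-j}`, and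
  `Tr e^{-β dWaveSourceTorus L U μ h} = e^{βμL²} · Tr e^{-β dΓ(𝓚₀)} · exp(Σ_{j ≥ 1} c_j(L; U, h))`

(`dWaveSourceTorus_partitionFn_eq_exp_doubleSeries`): at fixed temperature the finite-volume pressure of
the sourced Hubbard torus is a convergent DOUBLE power series in the repulsion `U` and the source `h`
around `(0, 0)`, with volume-independent radius and coefficients `O(L²)` — joint analyticity in coupling and
symmetry-breaking field, the fixed-temperature layer of the route ThermalWedge's sourced expansion (all
orders in `h` at once: pair susceptibility = order `h²`, etc.). The radius is that of the bare expansion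
(`∝ T`); the window `β ≤ e^{a/U}` of the route needs the multiscale analysis. Everything is PROVED; no
definition and no named fact.

## References
* G. Benfatto, A. Giuliani, V. Mastropietro, Ann. Henri Poincaré 7 (2006) 809–898, §2, (2.77).
  [cite: BenfattoGiulianiMastropietro2006, (2.77)]
* E. H. Lieb, Phys. Rev. Lett. 62 (1989) 1201–1204, proof of Thm 2. [cite: Lieb1989, proof of Theorem 2]
* W. de Siqueira Pedra, M. Salmhofer, Comm. Math. Phys. 282 (2008) 797–818, Thm 2.4. [cite: PedraSalmhofer2008, Thm 2.4]
-/

noncomputable section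

open scoped Matrix.Norms.L2Operator ComplexOrder
open Finset MeasureTheory Filter Topology NormedSpace Set
open Literature.Probability.LatticeModels

namespace Literature.MathematicalPhysics.QuantumLattice

-- the generic `DecidableEq` path on `Orb (FermionTorus 2 L)` (cf. `ShibaFreeThermalKernel`)
attribute [-instance] instDecidableEqLex

/-! ### Homogeneity of the weights: extracting `U^{j-m} h^m` -/

section Homogeneity

variable (L : ℕ) [NeZero L]

omit [NeZero L] in
/-- The weights scale linearly: `v_r(U,h) = U · v_r(1,1)` for interaction letters, `h · v_r(1,1)` for source
letters. [folklore] -/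
theorem dwsWeight_eq_scale_mul (U h : ℝ) (r : DwsType × FermionTorus 2 L) :
    dwsWeight L U h r = (if Sum.isRight r.1 then (h : ℂ) else (U : ℂ)) * dwsWeight L 1 1 r := by
  rcases r with ⟨t | ⟨i, ς, d⟩, x⟩
  · simp only [dwsWeight, Sum.isRight_inl, Bool.false_eq_true, if_false]
    split_ifs <;> push_cast <;> ring
  · simp only [dwsWeight, Sum.isRight_inr, if_true]
    push_cast
    ring

omit [NeZero L] in
/-- **The weight of a word with `m` source letters is `U^{j-m} h^m` times its weight at unit couplings.**
[folklore] -/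
theorem prod_dwsWeight_eq (U h : ℝ) {j : ℕ} (g : Fin j → DwsType × FermionTorus 2 L) :
    ∏ i, dwsWeight L U h (g i) =
      (U : ℂ) ^ (j - (univ.filter fun i => Sum.isRight (g i).1).card) *
        (h : ℂ) ^ (univ.filter fun i => Sum.isRight (g i).1).card * ∏ i, dwsWeight L 1 1 (g i) := by
  simp_rw [dwsWeight_eq_scale_mul L U h]
  rw [Finset.prod_mul_distrib, Finset.prod_ite, Finset.prod_const, Finset.prod_const]
  have hcard : (univ.filter fun i : Fin j => ¬ (Sum.isRight (g i).1 = true)).card =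
      j - (univ.filter fun i : Fin j => Sum.isRight (g i).1 = true).card := by
    rw [Finset.filter_not, Finset.card_sdiff_of_subset (filter_subset _ _), card_univ, Fintype.card_fin]
  rw [hcard]
  ring

variable (β : ℝ) (K : Matrix (Orb (FermionTorus 2 L)) (Orb (FermionTorus 2 L)) ℂ)

/-- The restricted connected integrand (words with a prescribed number of source letters, unit couplings)
is continuous. [folklore] -/
theorem continuous_wordUrsellIntegrandOn (j : ℕ) (S : Finset (Fin j → DwsType × FermionTorus 2 L)) :
    Continuous fun u : Fin j → ℝ => (-(β : ℂ)) ^ j * ∑ g ∈ S, (∏ i, dwsWeight L 1 1 (g i)) *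
      ursellOf (FermionicTree.moment (wordCluster 2 j)
        (wordPropMatrix β K (dwsOp L) (dwsOm L) g (fun i => ((u i : ℝ) : ℂ) * -(β : ℂ)))) univ := by
  refine continuous_const.mul (continuous_finsetSum _ fun g _ => continuous_const.mul ?_)
  refine FermionicTree.continuous_ursellOf
    (fun (w : Fin j → ℝ) P => FermionicTree.moment (wordCluster 2 j)
      (wordPropMatrix β K (dwsOp L) (dwsOm L) g (fun i => ((w i : ℝ) : ℂ) * -(β : ℂ))) P) (fun P => ?_) _
  exact FermionicTree.continuous_moment (wordCluster 2 j) _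
    (fun a b => continuous_wordPropMatrix_apply β K (dwsOp L) (dwsOm L) g a b) P

/-- **The connected integrand at couplings `(U, h)` is the sum over the number `m` of source letters of
`U^{j-m} h^m` times the restricted integrand at unit couplings.** [folklore] -/
theorem wordUrsellIntegrand_dws_eq_sum_range (U h : ℝ) (j : ℕ) (u : Fin j → ℝ) :
    wordUrsellIntegrand β K (dwsOp L) (dwsOm L) (dwsWeight L U h) j u =
      ∑ m ∈ Finset.range (j + 1), (U : ℂ) ^ (j - m) * (h : ℂ) ^ m *
        ((-(β : ℂ)) ^ j * ∑ g ∈ univ.filter (fun g : Fin j → DwsType × FermionTorus 2 L =>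
            (univ.filter fun i => Sum.isRight (g i).1).card = m),
          (∏ i, dwsWeight L 1 1 (g i)) *
            ursellOf (FermionicTree.moment (wordCluster 2 j)
              (wordPropMatrix β K (dwsOp L) (dwsOm L) g (fun i => ((u i : ℝ) : ℂ) * -(β : ℂ)))) univ) := by
  unfold wordUrsellIntegrand
  rw [← Finset.sum_fiberwise_of_maps_to (s := univ) (t := Finset.range (j + 1))
    (g := fun g : Fin j → DwsType × FermionTorus 2 L => (univ.filter fun i => Sum.isRight (g i).1).card)
    (fun g _ => Finset.mem_range.mpr (Nat.lt_succ_of_le ((card_filter_le _ _).trans (by simp))))]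
  rw [Finset.mul_sum]
  refine Finset.sum_congr rfl fun m _ => ?_
  rw [Finset.mul_sum, Finset.mul_sum, Finset.mul_sum]
  refine Finset.sum_congr rfl fun g hg => ?_
  rw [Finset.mem_filter] at hg
  rw [prod_dwsWeight_eq L U h g, hg.2]
  ring

/-- **The connected coefficients are homogeneous polynomials**:
`c_j(L; U, h) = Σ_{m ≤ j} C_{j,m}(L) U^{j-m} h^m`. [folklore] -/
theorem wordConnectedCoeff_dws_eq_sum_range (U h : ℝ) (j : ℕ) :
    orderedIntegral j (wordUrsellIntegrand β K (dwsOp L) (dwsOm L) (dwsWeight L U h) j) 1 =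
      ∑ m ∈ Finset.range (j + 1),
        orderedIntegral j (fun u : Fin j → ℝ => (-(β : ℂ)) ^ j *
          ∑ g ∈ univ.filter (fun g : Fin j → DwsType × FermionTorus 2 L =>
              (univ.filter fun i => Sum.isRight (g i).1).card = m),
            (∏ i, dwsWeight L 1 1 (g i)) *
              ursellOf (FermionicTree.moment (wordCluster 2 j)
                (wordPropMatrix β K (dwsOp L) (dwsOm L) g (fun i => ((u i : ℝ) : ℂ) * -(β : ℂ)))) univ) 1 *
          (U : ℂ) ^ (j - m) * (h : ℂ) ^ m := by
  set F : ℕ → (Fin j → ℝ) → ℂ := fun m u =>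
    ((-(β : ℂ)) ^ j * ∑ g ∈ univ.filter (fun g : Fin j → DwsType × FermionTorus 2 L =>
        (univ.filter fun i => Sum.isRight (g i).1).card = m),
      (∏ i, dwsWeight L 1 1 (g i)) *
        ursellOf (FermionicTree.moment (wordCluster 2 j)
          (wordPropMatrix β K (dwsOp L) (dwsOm L) g (fun i => ((u i : ℝ) : ℂ) * -(β : ℂ)))) univ) *
      ((U : ℂ) ^ (j - m) * (h : ℂ) ^ m) with hF
  have hfun : wordUrsellIntegrand β K (dwsOp L) (dwsOm L) (dwsWeight L U h) j =
      fun u => ∑ m ∈ Finset.range (j + 1), F m u := by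
    funext u
    rw [wordUrsellIntegrand_dws_eq_sum_range]
    refine Finset.sum_congr rfl fun m _ => ?_
    simp only [hF]
    ring
  have hFc : ∀ m ∈ Finset.range (j + 1), Continuous (F m) := fun m _ =>
    (continuous_wordUrsellIntegrandOn L β K j _).mul continuous_const
  rw [hfun, orderedIntegral_finset_sum (Finset.range (j + 1)) j hFc 1]
  refine Finset.sum_congr rfl fun m _ => ?_
  simp only [hF]
  rw [orderedIntegral_mul_const]
  ring

end Homogeneity

/-! ### The joint expansion -/

section Main

variable (β μ : ℝ)

/-- **Joint perturbation theory in the repulsion and the pair source converges uniformly in the volume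
(fixed temperature).** For every `β ≥ 0` and `μ` there are `δ > 0`, `ϱ > 0` with `ϱδ ≤ 1/3` and `A ≥ 0` such that for all
`L ≥ 3`, with `𝓚₀ = shibaOneBody τ_L Δ_{L,0} μ 0` and the restricted coefficients `C_{j,m}(L)` (words of `j`
letters, `m` of them source bond letters, unit couplings): (i) `‖C_{j,m}(L)‖ ≤ L² A ϱ^j` for `j ≥ 1`;
(ii) for all real `U, h` with `|U| ≤ δ`, `|h| ≤ δ`: the connected coefficients of the sourced interacting torus
are `c_j(L;U,h) = Σ_{m ≤ j} C_{j,m}(L) U^{j-m} h^m` with `‖c_j‖ ≤ L² A (j+1) 3^{-j}`, and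
`Tr e^{-β dWaveSourceTorus L U μ h} = e^{βμL²} · Tr e^{-β dΓ(𝓚₀)} · exp(Σ_{j≥1} c_j(L;U,h))`.
[cite: BenfattoGiulianiMastropietro2006, (2.77)] -/
theorem dWaveSourceTorus_partitionFn_eq_exp_doubleSeries (hβ : 0 ≤ β) :
    ∃ δ : ℝ, 0 < δ ∧ ∃ ϱ : ℝ, 0 < ϱ ∧ ϱ * δ ≤ 1 / 3 ∧ ∃ A : ℝ, 0 ≤ A ∧ ∀ (L : ℕ) [NeZero L], 3 ≤ L →
      (∀ j m : ℕ, 1 ≤ j →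
        ‖orderedIntegral j (fun u : Fin j → ℝ => (-(β : ℂ)) ^ j *
            ∑ g ∈ univ.filter (fun g : Fin j → DwsType × FermionTorus 2 L =>
                (univ.filter fun i => Sum.isRight (g i).1).card = m),
              (∏ i, dwsWeight L 1 1 (g i)) *
                ursellOf (FermionicTree.moment (wordCluster 2 j)
                  (wordPropMatrix β (shibaOneBody (dwsHopping L) (dwsPairing L 0) μ ((0 : ℝ) : ℂ))
                    (dwsOp L) (dwsOm L) g (fun i => ((u i : ℝ) : ℂ) * -(β : ℂ)))) univ) 1‖ ≤
          (L : ℝ) ^ 2 * A * ϱ ^ j) ∧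
      ∀ U h : ℝ, |U| ≤ δ → |h| ≤ δ →
        (∀ j : ℕ, orderedIntegral j (wordUrsellIntegrand β
              (shibaOneBody (dwsHopping L) (dwsPairing L 0) μ ((0 : ℝ) : ℂ))
              (dwsOp L) (dwsOm L) (dwsWeight L U h) j) 1 =
            ∑ m ∈ Finset.range (j + 1),
              orderedIntegral j (fun u : Fin j → ℝ => (-(β : ℂ)) ^ j *
                ∑ g ∈ univ.filter (fun g : Fin j → DwsType × FermionTorus 2 L =>
                    (univ.filter fun i => Sum.isRight (g i).1).card = m),
                  (∏ i, dwsWeight L 1 1 (g i)) *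
                    ursellOf (FermionicTree.moment (wordCluster 2 j)
                      (wordPropMatrix β (shibaOneBody (dwsHopping L) (dwsPairing L 0) μ ((0 : ℝ) : ℂ))
                        (dwsOp L) (dwsOm L) g (fun i => ((u i : ℝ) : ℂ) * -(β : ℂ)))) univ) 1 *
                (U : ℂ) ^ (j - m) * (h : ℂ) ^ m) ∧
        (∀ j : ℕ, 1 ≤ j → ‖orderedIntegral j (wordUrsellIntegrand β
              (shibaOneBody (dwsHopping L) (dwsPairing L 0) μ ((0 : ℝ) : ℂ))
              (dwsOp L) (dwsOm L) (dwsWeight L U h) j) 1‖ ≤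
            (L : ℝ) ^ 2 * A * ((j : ℝ) + 1) * (1 / 3) ^ j) ∧
        Matrix.partitionFn β (dWaveSourceTorus L U μ h) =
          (Real.exp (β * (μ * (L : ℝ) ^ 2)) : ℂ) *
            Matrix.partitionFn β (dGamma (shibaOneBody (dwsHopping L) (dwsPairing L 0) μ ((0 : ℝ) : ℂ))) *
            Complex.exp (∑' j : ℕ, if j = 0 then 0 else orderedIntegral j (wordUrsellIntegrand β
              (shibaOneBody (dwsHopping L) (dwsPairing L 0) μ ((0 : ℝ) : ℂ))
              (dwsOp L) (dwsOm L) (dwsWeight L U h) j) 1) := by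
  classical
  -- the decay of the thermal kernel of `𝓚₀` (the case `h = U = 0` of `ShibaThermalKernelDecay`)
  obtain ⟨κ, hκ, C', hC'0, hΓ⟩ := exists_norm_shibaThermalKernel_apply_le β μ hβ
  set S : ℝ := ∑' z : Site 2, ((1 + ‖z‖) ^ 4)⁻¹ with hS
  have hS0 : 0 ≤ S := tsum_nonneg fun z => by positivity
  -- the constants
  set Γ : ℝ := 81 * C' * S with hΓdef
  have hΓ0 : 0 ≤ Γ := by positivity
  set G : ℝ := 2 * ((2 : ℕ) : ℝ) ^ 2 * Γ + 1 with hGdef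
  have hGpos : 0 < G := by positivity
  set W₁ : ℝ := 2 + 8 * Real.sqrt 2 with hW₁
  have hW₁pos : 0 < W₁ := by positivity
  set ϱ₀ : ℝ := Real.exp 1 * β * 2 ^ (2 : ℕ) * G with hϱ₀
  have hϱ₀0 : 0 ≤ ϱ₀ := by positivity
  set ϱ : ℝ := ϱ₀ * W₁ + 1 with hϱ
  have hϱ1 : 1 ≤ ϱ := by
    have h0 : 0 ≤ ϱ₀ * W₁ := by positivity
    rw [hϱ]; linarith
  have hϱpos : 0 < ϱ := by linarith
  set δ : ℝ := (3 * ϱ)⁻¹ with hδ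
  have hδpos : 0 < δ := by positivity
  have hδϱ : ϱ * δ = 1 / 3 := by rw [hδ]; field_simp
  refine ⟨δ, hδpos, ϱ, hϱpos, le_of_eq hδϱ, G⁻¹, by positivity, ?_⟩
  intro L _ hL
  -- `𝓚₀` and its kernel bound
  have hK : (shibaOneBody (dwsHopping L) (dwsPairing L 0) μ ((0 : ℝ) : ℂ)).IsHermitian := by
    refine isHermitian_shibaOneBody (fun x y => ?_) _ μ 0
    simp only [dwsHopping, apply_ite star, star_neg, star_one, star_zero, (fermionTorusGraph 2 L).adj_comm x y]
  have hΓ0 := hΓ L hL 0 0 (by rw [abs_zero]; exact hκ.le) (by rw [abs_zero]; exact hκ.le)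
  -- sites ↔ torus points, and the line weight
  set pos : FermionTorus 2 L ≃ TorusSite 2 L :=
    ⟨FermionTorus.toTorusSite, FermionTorus.ofTorusSite, FermionTorus.ofTorusSite_toTorusSite,
      FermionTorus.toTorusSite_ofTorusSite⟩ with hpos
  set γ : TorusSite 2 L → ℝ := fun u => 81 * C' * ((1 + (Torus.tnorm u : ℝ)) ^ 4)⁻¹ with hγ
  have hγ0 : ∀ u, 0 ≤ γ u := fun u => by positivity
  have hγeven : ∀ u, γ (-u) = γ u := fun u => by simp only [hγ, Torus.tnorm_neg]
  have hsumγ : ∑ u, γ u ≤ Γ := by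
    simp only [hγ, hΓdef]
    rw [← Finset.mul_sum]
    exact mul_le_mul_of_nonneg_left (sum_inv_one_add_tnorm_pow_le_tsum (L := L) le_rfl) (by positivity)
  -- the line bound for every type pattern
  have hG : ∀ (j : ℕ) (u : Fin j → ℝ), Monotone u → (∀ i, u i ∈ Icc (0 : ℝ) 1) →
      ∀ (t : Fin j → DwsType) (g : Fin j → FermionTorus 2 L) (a b : Fin (j * 2)),
        ‖wordPropMatrix β (shibaOneBody (dwsHopping L) (dwsPairing L 0) μ ((0 : ℝ) : ℂ)) (dwsOp L) (dwsOm L)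
            (fun i => (t i, g i)) (fun i => ((u i : ℝ) : ℂ) * -(β : ℂ)) a b‖ ≤
          γ (pos (g (wordCluster 2 j a)) - pos (g (wordCluster 2 j b))) :=
    fun j u hum hu01 t g a b =>
      norm_wordPropMatrix_dws_apply_le β hβ hK hC'0 hΓ0 u hum hu01 t g a b
  -- weights
  have hw0 : ∀ U h : ℝ, ∀ s : DwsType, 0 ≤ dwsBound U h s := fun U h s => dwsBound_nonneg U h s
  have hw : ∀ U h : ℝ, ∀ (s : DwsType) (x : FermionTorus 2 L), ‖dwsWeight L U h (s, x)‖ ≤ dwsBound U h s :=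
    fun U h s x => norm_dwsWeight_le L U h s x
  have hW₁sum : ∑ s : DwsType, dwsBound 1 1 s ≤ W₁ := by
    rw [sum_dwsBound, abs_one, hW₁]; linarith
  have hcard : (Fintype.card (TorusSite 2 L) : ℝ) = (L : ℝ) ^ 2 := by
    rw [show Fintype.card (TorusSite 2 L) = L ^ 2 by
      simp only [TorusSite, Fintype.card_pi, ZMod.card, Finset.prod_const, Finset.card_univ, Fintype.card_fin]]
    push_cast
    ring
  refine ⟨fun j m hj => ?_, fun U h hU hh => ?_⟩
  · -- (i) the coefficient bounds, at unit couplings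
    have key := norm_wordConnectedCoeffOn_le_geometric β
      (shibaOneBody (dwsHopping L) (dwsPairing L 0) μ ((0 : ℝ) : ℂ)) (dwsOp L) (dwsOm L) (dwsWeight L 1 1)
      hK hβ pos (dwsBound 1 1) (hw0 1 1) (hw 1 1) W₁ hW₁sum γ hγ0 hγeven Γ hsumγ hj (hG j)
      (univ.filter fun g : Fin j → DwsType × FermionTorus 2 L =>
        (univ.filter fun i => Sum.isRight (g i).1).card = m)
    refine key.trans ?_
    rw [hcard]
    have hϱle : Real.exp 1 * β * W₁ * 2 ^ (2 : ℕ) * G ≤ ϱ := by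
      rw [hϱ, hϱ₀]; nlinarith [Real.exp_pos 1, hW₁pos, hGpos, hβ]
    have hϱ00 : 0 ≤ Real.exp 1 * β * W₁ * 2 ^ (2 : ℕ) * G := by positivity
    have := pow_le_pow_left₀ hϱ00 hϱle j
    have hL2 : 0 ≤ (L : ℝ) ^ 2 * G⁻¹ := by positivity
    calc (L : ℝ) ^ 2 * (2 * ((2 : ℕ) : ℝ) ^ 2 * Γ + 1)⁻¹ * (Real.exp 1 * β * W₁ * 2 ^ (2 : ℕ) *
          (2 * ((2 : ℕ) : ℝ) ^ 2 * Γ + 1)) ^ j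
        = (L : ℝ) ^ 2 * G⁻¹ * (Real.exp 1 * β * W₁ * 2 ^ (2 : ℕ) * G) ^ j := by rw [hGdef]
      _ ≤ (L : ℝ) ^ 2 * G⁻¹ * ϱ ^ j := mul_le_mul_of_nonneg_left this hL2
  · -- (ii) at couplings `(U, h)` with `|U|, |h| ≤ δ`
    have hWUh : ∑ s : DwsType, dwsBound U h s ≤ W₁ * δ := by
      rw [sum_dwsBound, hW₁]
      have h2 : 0 ≤ Real.sqrt 2 := Real.sqrt_nonneg 2
      nlinarith [abs_nonneg U, abs_nonneg h]
    have hsmall : Real.exp 1 * β * (W₁ * δ) * 2 ^ (2 : ℕ) * G * ‖(1 : ℂ)‖ < 1 := by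
      rw [norm_one, mul_one]
      calc Real.exp 1 * β * (W₁ * δ) * 2 ^ (2 : ℕ) * G = ϱ₀ * W₁ * δ := by rw [hϱ₀]; ring
        _ ≤ ϱ * δ := by
            refine mul_le_mul_of_nonneg_right ?_ hδpos.le
            rw [hϱ]; linarith
        _ = 1 / 3 := hδϱ
        _ < 1 := by norm_num
    have main := partitionFn_pairWord_eq_exp_connected β
      (shibaOneBody (dwsHopping L) (dwsPairing L 0) μ ((0 : ℝ) : ℂ)) (dwsOp L) (dwsOm L) (dwsWeight L U h)
      hK hβ pos (dwsBound U h) (hw0 U h) (hw U h) (W₁ * δ) hWUh γ hγ0 hγeven Γ hsumγ hG 1 hsmall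
    obtain ⟨hZ, -⟩ := main
    have hrep := fun j => wordConnectedCoeff_dws_eq_sum_range L β
      (shibaOneBody (dwsHopping L) (dwsPairing L 0) μ ((0 : ℝ) : ℂ)) U h j
    refine ⟨hrep, fun j hj => ?_, ?_⟩
    · -- the bound on `c_j(U,h)` from the coefficient bounds
      rw [hrep j]
      have hUδ : ‖(U : ℂ)‖ ≤ δ := by rw [Complex.norm_real, Real.norm_eq_abs]; exact hU
      have hhδ : ‖(h : ℂ)‖ ≤ δ := by rw [Complex.norm_real, Real.norm_eq_abs]; exact hh
      have hterm : ∀ m ∈ Finset.range (j + 1),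
          ‖orderedIntegral j (fun u : Fin j → ℝ => (-(β : ℂ)) ^ j *
              ∑ g ∈ univ.filter (fun g : Fin j → DwsType × FermionTorus 2 L =>
                  (univ.filter fun i => Sum.isRight (g i).1).card = m),
                (∏ i, dwsWeight L 1 1 (g i)) *
                  ursellOf (FermionicTree.moment (wordCluster 2 j)
                    (wordPropMatrix β (shibaOneBody (dwsHopping L) (dwsPairing L 0) μ ((0 : ℝ) : ℂ))
                      (dwsOp L) (dwsOm L) g (fun i => ((u i : ℝ) : ℂ) * -(β : ℂ)))) univ) 1 *
            (U : ℂ) ^ (j - m) * (h : ℂ) ^ m‖ ≤ (L : ℝ) ^ 2 * G⁻¹ * (1 / 3) ^ j := by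
        intro m hm
        have hmj : m ≤ j := Nat.lt_succ_iff.mp (Finset.mem_range.mp hm)
        rw [norm_mul, norm_mul, norm_pow, norm_pow]
        have hC := norm_wordConnectedCoeffOn_le_geometric β
          (shibaOneBody (dwsHopping L) (dwsPairing L 0) μ ((0 : ℝ) : ℂ)) (dwsOp L) (dwsOm L) (dwsWeight L 1 1)
          hK hβ pos (dwsBound 1 1) (hw0 1 1) (hw 1 1) W₁ hW₁sum γ hγ0 hγeven Γ hsumγ hj (hG j)
          (univ.filter fun g : Fin j → DwsType × FermionTorus 2 L =>
            (univ.filter fun i => Sum.isRight (g i).1).card = m)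
        rw [hcard] at hC
        have hϱle : Real.exp 1 * β * W₁ * 2 ^ (2 : ℕ) * (2 * ((2 : ℕ) : ℝ) ^ 2 * Γ + 1) ≤ ϱ := by
          rw [hϱ, hϱ₀, hGdef]; nlinarith [Real.exp_pos 1, hW₁pos, hGpos, hβ]
        have hϱ00 : 0 ≤ Real.exp 1 * β * W₁ * 2 ^ (2 : ℕ) * (2 * ((2 : ℕ) : ℝ) ^ 2 * Γ + 1) := by positivity
        have hpow := pow_le_pow_left₀ hϱ00 hϱle j
        have h1 := hC.trans (mul_le_mul_of_nonneg_left hpow (by positivity : (0 : ℝ) ≤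
          (L : ℝ) ^ 2 * (2 * ((2 : ℕ) : ℝ) ^ 2 * Γ + 1)⁻¹))
        have h2 : ‖(U : ℂ)‖ ^ (j - m) ≤ δ ^ (j - m) := pow_le_pow_left₀ (norm_nonneg _) hUδ _
        have h3 : ‖(h : ℂ)‖ ^ m ≤ δ ^ m := pow_le_pow_left₀ (norm_nonneg _) hhδ _
        calc _ ≤ (L : ℝ) ^ 2 * (2 * ((2 : ℕ) : ℝ) ^ 2 * Γ + 1)⁻¹ * ϱ ^ j * δ ^ (j - m) * δ ^ m :=
              mul_le_mul (mul_le_mul h1 h2 (by positivity) (by positivity)) h3 (by positivity) (by positivity)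
          _ = (L : ℝ) ^ 2 * G⁻¹ * (ϱ * δ) ^ j := by
              rw [hGdef, mul_pow ϱ δ j, mul_assoc _ (δ ^ (j - m)), ← pow_add, Nat.sub_add_cancel hmj]
              ring
          _ = (L : ℝ) ^ 2 * G⁻¹ * (1 / 3) ^ j := by rw [hδϱ]
      calc _ ≤ ∑ m ∈ Finset.range (j + 1), (L : ℝ) ^ 2 * G⁻¹ * (1 / 3) ^ j := norm_sum_le_of_le _ hterm
        _ = (L : ℝ) ^ 2 * G⁻¹ * ((j : ℝ) + 1) * (1 / 3) ^ j := by
            rw [Finset.sum_const, Finset.card_range, nsmul_eq_mul]; push_cast; ring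
    · -- the partition function
      have hts : (∑' j : ℕ, (if j = 0 then 0 else orderedIntegral j (wordUrsellIntegrand β
          (shibaOneBody (dwsHopping L) (dwsPairing L 0) μ ((0 : ℝ) : ℂ))
          (dwsOp L) (dwsOm L) (dwsWeight L U h) j) 1) * (1 : ℂ) ^ j) =
          ∑' j : ℕ, (if j = 0 then 0 else orderedIntegral j (wordUrsellIntegrand β
            (shibaOneBody (dwsHopping L) (dwsPairing L 0) μ ((0 : ℝ) : ℂ))
            (dwsOp L) (dwsOm L) (dwsWeight L U h) j) 1) :=
        tsum_congr fun j => by rw [one_pow, mul_one]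
      rw [partitionFn_dWaveSourceTorus_eq_pairWord, hZ, hts, mul_assoc]

end Main

end Literature.MathematicalPhysics.QuantumLattice
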